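import Literature.AlgebraicGeometry.ModuliOfAbelianVarieties.SiegelFamilyHumbertQuaternionAlgebra
import Literature.AlgebraicGeometry.ModuliOfAbelianVarieties.SiegelFamilyHumbertSymmetricEndomorphism
import Mathlib.LinearAlgebra.Matrix.Nondegenerate
import HarnessLib

/-!
# Runge's reduced trace form on `ℚ(α, β)`: `x² − t(x)x + n(x) = 0` for every element, the Gram matrix
# `(t(xᵢxⱼ))` of `(1, α, β, αβ)` and the discriminant `d(1, α, β, αβ)² = −det(t(xᵢxⱼ)) = (det S_Δ / 4)²`
# (Runge 1999, §6 p. 294 and Thm. 7)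

Layer `Literature/AlgebraicGeometry/ModuliOfAbelianVarieties`, namespace
`Literature.AlgebraicGeometry.ModuliOfAbelianVarieties.SiegelModuli`; lane `lit-hodgefound` (Track 2 foundations
library, Layer A4 "cycle classes / Hodge classes / Lefschetz (1,1)"), seat `lit-hodgefound-skel-4`, row **A4-67**,
FILE 1. Sequel of row A4-66 (`SiegelFamilyHumbertDiscriminantForm`: Runge's Lemma 8
`αβ + βα = t(α)β + t(β)α − n(α, β)` for the Rosati matrices `X(m, q)`, `X(n, q′)` of two singular relations and the
integer dictionary `redTrace`, `redNorm`, `redNormPolar`, `humbertPolar`; `SiegelFamilyHumbertQuaternionAlgebra`: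
`ℚ(α, β) = humbertPairAlg q q′ = ℚ1 + ℚα + ℚβ + ℚαβ ⊆ M₄(ℚ)`). PURE MATRIX ALGEBRA over `ℤ` and `ℚ`.

## Source followed, verbatim (B. Runge, *Endomorphism rings of abelian surfaces and projective models of their moduli
## spaces*, Tohoku Math. J. 51 (1999), held text `paper:doi-10-2748-tmj-1178224764`, §6 pp. 294–296)

* p. 294: "In a rational quaternion algebra `A` any element satisfies an equation `x² − t(x)x + n(x) = 0`, where `t(x)`
  and `n(x)` are called the reduced trace and norm (see [E]). The map `n : A → ℚ` is multiplicative and `t : A → ℚ` is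
  additive. The main anti-involution is defined by `x̄ = t(x) − x` and the "Zwischennorm" is defined by
  `n(x, y) = n(x + y) − n(x) − n(y) = n(y, x) = t(x)t(y) − t(xy) = xȳ + yx̄ = ȳx + x̄y`. The discriminant form is defined
  by `Δ(x, y) = ½(Δ(x + y) − Δ(x) − Δ(y)) = 2t(xy) − t(x)t(y) = t(x)t(y) − 2n(x, y)`, and the discriminant
  `d(x₁, x₂, x₃, x₄)` of a module generated by `x₁, …, x₄` is defined by `d(x₁, x₂, x₃, x₄)² = −det(t(xᵢxⱼ))`. Obviously,
  `n(x, x) = 2n(x) = 2xx̄`, `Δ(x) = Δ(x, x) = t(x)² − 4n(x)` and `n(x, 1) = t(x)`. While the sign of the discriminant varies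
  in the literature, we always choose the positive sign. […] The discriminant form is identically zero on `ℚ`, and hence
  determines a ternary quadratic form on `A/ℚ`."
* pp. 294–295, **THEOREM 7.** "Any QCM-order can be written as `R = ℤ ⊕ ℤα ⊕ ℤβ ⊕ ℤαβ`, where `α` and `β` are primitive
  Rosati invariant elements of positive discriminant `Δ(α)`, `Δ(β)`, such that the discriminant matrix
  `S_Δ = (Δ(α) Δ(α,β); Δ(α,β) Δ(β))` is positive definite. The discriminant of `R` is `d(R) = det(S_Δ)/4`."
  Proof, p. 295: "Moreover, up to multiplication by a non-zero rational number, the element `γ = αβ − βα` is a unique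
  element with `γ̄ = −γ`. The algebra `R ⊗ ℚ` is admissible if and only if `γ² = −n(γ) = (Δ(α, β)² − Δ(α)Δ(β))/4` is a
  negative number. […] The computation of the discriminant is omitted."

The exponent in the display defining `d` (garbled in the held OCR text) is confirmed by Theorem 7's value: for the basis
`(1, α, β, αβ)` one finds `−det(t(xᵢxⱼ)) = ((Δ(α,β)² − Δ(α)Δ(β))/4)² = (det S_Δ/4)²` (this file,
`det_pairGram`), e.g. `16 n(α)² n(β)²` for an anticommuting pair with `t(α) = t(β) = 0`.

## Dictionary and contents (definitions with bodies and proved theorems; NO named fact, net debt 0)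

On `M₄(ℚ) ⊇ ℚ(α, β)` the reduced trace is realised as **`t = ½·Tr`** (`rungeTrace`; on the Rosati matrices this is
Runge's `t(M) = Tr(A)`, p. 288, = row A4-66's `redTrace`, and on all of `ℚ(α, β)` it is the unique linear functional with
`t(1) = 2` and `x² − t(x)x ∈ ℚ·1`, `mul_self_sub_rungeTrace_smul_add`), `n(x) := ½(t(x)² − t(x²))` (`rungeNorm`, the
constant term of that quadratic equation), `n(x, y)`, `Δ(x)`, `Δ(x, y)` as printed (`rungeNormPolar`, `rungeDisc`,
`rungeDiscPolar`).
* §1 the calculus of `t, n, n(·,·), Δ, Δ(·,·)` on `M₄(ℚ)`: `rungeTrace_one` (`t(1) = 2`), `rungeNormPolar_eq`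
  (`n(x,y) = t(x)t(y) − t(xy)`), `rungeNormPolar_self` (`n(x,x) = 2n(x)`), `rungeNormPolar_one_right` (`n(x,1) = t(x)`),
  `rungeDiscPolar_eq_two_mul_sub` / `rungeDiscPolar_eq_sub_two_mul` (the two printed formulas for `Δ(x,y)`),
  `rungeDiscPolar_self`, `rungeDiscPolar_smul_one_left` / `rungeDisc_add_smul_one` ("identically zero on `ℚ`").
* §2 the dictionary with row A4-66 FILE 1: `rungeTrace/rungeNorm/rungeDisc_map_rosatiMatrix` (`= redTrace m q`,
  `redNorm m q`, `humbertInvariant q`), `rungeNormPolar_map_rosatiMatrix` (`= redNormPolar`),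
  **`rungeDiscPolar_map_rosatiMatrix`** (`Δ(X(m,q), X(n,q′)) = humbertPolar q q′`).
* §3 the remaining anticommutators of the spanning set `(1, α, β, αβ)`, `α = R₀(q)`, `β = R₀(q′)`, over `ℤ`
  (Lemma 8 polarised with `αβ`; "`n` is multiplicative"): `humbertRatRep_mul_pair_add_pair_mul`
  (`α(αβ) + (αβ)α = b·αβ + (bb′ − N(q,q′))·α − b′(ac + de)·1`), `humbertRatRep_mul_pair_add_pair_mul'`,
  **`humbertRatRep_pair_mul_pair`** (`(αβ)² = t(αβ)·αβ − n(α)n(β)·1`); the integer `gammaSq q q′ = n(γ)·(−1) = γ²` with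
  `four_mul_gammaSq` (`4γ² = Δ(q,q′)² − Δ(q)Δ(q′) = −det S_Δ`) and **`humbertComm_mul_self`** (`γ² = gammaSq·1`,
  Runge's "`γ² = (Δ(α,β)² − Δ(α)Δ(β))/4`" with the division performed).
* §4 **`mul_self_sub_rungeTrace_smul_add`** — "any element satisfies `x² − t(x)x + n(x) = 0`" for every
  `x ∈ ℚ(α, β)`; `mul_add_mul_eq_of_mem` (Lemma 8's identity for ALL pairs `x, y ∈ ℚ(α, β)`), `mul_rungeBar_of_mem`
  (`x x̄ = n(x)·1`).
* §5 the trace form: `traceGram x = (t(xᵢxⱼ))`, **`rungeDiscrSq x = −det(t(xᵢxⱼ))`** (Runge's `d(x₁,…,x₄)²`),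
  `traceGram_linComb` / `rungeDiscrSq_linComb` (change of generators `x′ = Px`: `d′² = det(P)² d²`, so `d` is an
  invariant of the `ℤ`-module when `det P = ±1`), the integer Gram matrix **`pairGram q q′`** of `(1, α, β, αβ)` with
  `traceGram_humbertPairFam`, **`det_pairGram`** (`det(t(xᵢxⱼ)) = −(γ²)²`, the omitted computation),
  **`rungeDiscrSq_humbertPairFam`** (`d(1, α, β, αβ)² = ((Δ(q)Δ(q′) − Δ(q,q′)²)/4)² = (det S_Δ/4)²`),
  `four_dvd_det_discMatrix'` (`4 ∣ det S_Δ`), and **`linearIndependent_humbertPairFam`**: `1, α, β, αβ` are linearly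
  independent over `ℚ` as soon as `det S_Δ ≠ 0` (non-degenerate trace form) — row A4-66 FILE 2's
  `linearIndependent_one_humbertRatRep_pair` without its hypothesis `Δ(q) ≠ 0`; `finrank_humbertPairAlg_of_det_ne_zero`.

## Scope

* Runge's `t`, `n` are the reduced trace and norm of the abstract quaternion algebra `A`; here `A = ℚ(α, β) ⊆ M₄(ℚ)` and
  `t := ½·Tr_{M₄}` is justified by §4 (`x² − t(x)x + n(x)·1 = 0` on `A`, `t(1) = 2`), which characterises the reduced
  trace on a quaternion algebra; the identification with the tree's abstract `reducedTrace ℚ A`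
  (`NumberTheory/Automorphic/QuaternionAlgebraAdelic`) is not spelled out.
* The square root `d = +√(−det(t(xᵢxⱼ)))` is not taken here: FILE 2 (`SiegelFamilyHumbertPairOrder`) records
  `d(ℤ[α, β]) = det(S_Δ)/4` as the positive integer `−gammaSq q q′` at the points of `H_q ∩ H_{q′} ⊂ 𝔥₂`, where `S_Δ` is
  positive definite (row A4-66 FILE 3), together with the order `ℤ[α, β] = ℤ ⊕ ℤα ⊕ ℤβ ⊕ ℤαβ` of Theorem 7 / Cor. 9.

## References

* [Runge1999EndomorphismRingsAbelianSurfaces] B. Runge, *Endomorphism rings of abelian surfaces and projective models of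
  their moduli spaces*, Tohoku Math. J. 51 (1999) 283–303, §4 p. 288; §6 pp. 294–296 (Thm. 7, Lemma 8, Cor. 9).
* [BirkenhakeWilhelm2003] Ch. Birkenhake, H. Wilhelm, *Humbert surfaces and the Kummer plane*, Trans. AMS 355 (2003),
  §4 eq. (9), Prop. 4.3, Cor. 4.4 (pp. 1827–1828).
-/

noncomputable section

open Matrix Module Function

namespace Literature.AlgebraicGeometry.ModuliOfAbelianVarieties

namespace SiegelModuli

open Literature.Geometry.Kaehler Literature.Geometry.Kaehler.ComplexTorus
open Sum

/-- `M₄(ℚ)` on the index set `Fin 2 ⊕ Fin 2` of the lattice basis `(x₁, x₂, y₁, y₂)`. -/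
local notation "𝕄" => Matrix (Fin 2 ⊕ Fin 2) (Fin 2 ⊕ Fin 2) ℚ

/-! ## §0 Casting bookkeeping `M₄(ℤ) → M₄(ℚ)` -/

section Cast

variable {ι : Type*}

/-- Casting commutes with products. [folklore] -/
private theorem castQ_mul [Fintype ι] (A B : Matrix ι ι ℤ) :
    (A * B).map (Int.cast : ℤ → ℚ) = A.map (Int.cast : ℤ → ℚ) * B.map (Int.cast : ℤ → ℚ) := by
  ext i j; simp [Matrix.mul_apply]

/-- Casting commutes with sums. [folklore] -/
private theorem castQ_add (A B : Matrix ι ι ℤ) :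
    (A + B).map (Int.cast : ℤ → ℚ) = A.map (Int.cast : ℤ → ℚ) + B.map (Int.cast : ℤ → ℚ) := by
  ext i j; simp

/-- Casting commutes with differences. [folklore] -/
private theorem castQ_sub (A B : Matrix ι ι ℤ) :
    (A - B).map (Int.cast : ℤ → ℚ) = A.map (Int.cast : ℤ → ℚ) - B.map (Int.cast : ℤ → ℚ) := by
  ext i j; simp

/-- Casting commutes with integer scalars. [folklore] -/
private theorem castQ_smul (c : ℤ) (A : Matrix ι ι ℤ) :
    (c • A).map (Int.cast : ℤ → ℚ) = (c : ℚ) • A.map (Int.cast : ℤ → ℚ) := by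
  ext i j; simp

/-- Casting preserves `1`. [folklore] -/
private theorem castQ_one [DecidableEq ι] : (1 : Matrix ι ι ℤ).map (Int.cast : ℤ → ℚ) = 1 := by
  ext i j; simp [Matrix.one_apply]

/-- Casting commutes with the trace. [folklore] -/
private theorem trace_castQ [Fintype ι] (A : Matrix ι ι ℤ) :
    (A.map (Int.cast : ℤ → ℚ)).trace = ((A.trace : ℤ) : ℚ) := by
  simp [Matrix.trace, Matrix.diag]

end Cast

/-! ## §1 Runge's `t`, `n`, `n(·,·)`, `Δ`, `Δ(·,·)` on `M₄(ℚ)` -/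

section TraceCalculus

/-- **Runge's reduced trace `t`**, realised on `M₄(ℚ) ⊇ ℚ(α, β)` as half the matrix trace: on a Rosati-invariant matrix
`M = (A B; C ᵗA)` this is "the reduced trace `t(M) = Tr(A)`" (p. 288), and on the quaternion algebra `ℚ(α, β)` it is the
reduced trace (`mul_self_sub_rungeTrace_smul_add`: "any element satisfies `x² − t(x)x + n(x) = 0`", `t(1) = 2`).
[cite: Runge1999EndomorphismRingsAbelianSurfaces, §4 p. 288 and §6 p. 294] -/
def rungeTrace : 𝕄 →ₗ[ℚ] ℚ := (2 : ℚ)⁻¹ • Matrix.traceLinearMap (Fin 2 ⊕ Fin 2) ℚ ℚ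

/-- `t(x) = ½ Tr(x)`. [cite: Runge1999EndomorphismRingsAbelianSurfaces, §4 p. 288] -/
theorem rungeTrace_apply (x : 𝕄) : rungeTrace x = x.trace / 2 := by
  simp [rungeTrace, div_eq_inv_mul]

/-- `2t(x) = Tr(x)`. [cite: Runge1999EndomorphismRingsAbelianSurfaces, §4 p. 288] -/
theorem two_mul_rungeTrace (x : 𝕄) : 2 * rungeTrace x = x.trace := by
  rw [rungeTrace_apply]; ring

/-- **`t(1) = 2`** (the reduced trace of `1` in a quaternion algebra). [cite: Runge1999EndomorphismRingsAbelianSurfaces, §6 p. 294] -/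
theorem rungeTrace_one : rungeTrace (1 : 𝕄) = 2 := by
  rw [rungeTrace_apply, Matrix.trace_one, Fintype.card_sum, Fintype.card_fin]; norm_num

/-- `t(c·1) = 2c`. [cite: Runge1999EndomorphismRingsAbelianSurfaces, §6 p. 294] -/
theorem rungeTrace_smul_one (c : ℚ) : rungeTrace (c • (1 : 𝕄)) = 2 * c := by
  rw [map_smul, rungeTrace_one, smul_eq_mul, mul_comm]

/-- `t(xy) = t(yx)`. [cite: Runge1999EndomorphismRingsAbelianSurfaces, §6 p. 294] -/
theorem rungeTrace_mul_comm (x y : 𝕄) : rungeTrace (x * y) = rungeTrace (y * x) := by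
  rw [rungeTrace_apply, rungeTrace_apply, Matrix.trace_mul_comm]

/-- **Runge's reduced norm `n(x)`**, the constant term of "`x² − t(x)x + n(x) = 0`": `n(x) := ½(t(x)² − t(x²))`
(equivalently `n(x, x) = 2n(x)` with `n(x, y) = t(x)t(y) − t(xy)`). [cite: Runge1999EndomorphismRingsAbelianSurfaces, §6 p. 294] -/
def rungeNorm (x : 𝕄) : ℚ := (rungeTrace x ^ 2 - rungeTrace (x * x)) / 2

/-- Unfolding of `rungeNorm`. [cite: Runge1999EndomorphismRingsAbelianSurfaces, §6 p. 294] -/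
theorem rungeNorm_def (x : 𝕄) : rungeNorm x = (rungeTrace x ^ 2 - rungeTrace (x * x)) / 2 := rfl

/-- **Runge's "Zwischennorm" `n(x, y) = n(x + y) − n(x) − n(y)`.** [cite: Runge1999EndomorphismRingsAbelianSurfaces, §6 p. 294] -/
def rungeNormPolar (x y : 𝕄) : ℚ := rungeNorm (x + y) - rungeNorm x - rungeNorm y

/-- **`n(x, y) = t(x)t(y) − t(xy)`.** [cite: Runge1999EndomorphismRingsAbelianSurfaces, §6 p. 294] -/
theorem rungeNormPolar_eq (x y : 𝕄) : rungeNormPolar x y = rungeTrace x * rungeTrace y - rungeTrace (x * y) := by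
  simp only [rungeNormPolar, rungeNorm, map_add, add_mul, mul_add, rungeTrace_mul_comm y x]
  ring

/-- `n(x, y) = n(y, x)`. [cite: Runge1999EndomorphismRingsAbelianSurfaces, §6 p. 294] -/
theorem rungeNormPolar_comm (x y : 𝕄) : rungeNormPolar x y = rungeNormPolar y x := by
  rw [rungeNormPolar_eq, rungeNormPolar_eq, rungeTrace_mul_comm, mul_comm]

/-- `n(x, x) = 2n(x)`. [cite: Runge1999EndomorphismRingsAbelianSurfaces, §6 p. 294] -/
theorem rungeNormPolar_self (x : 𝕄) : rungeNormPolar x x = 2 * rungeNorm x := by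
  rw [rungeNormPolar_eq, rungeNorm]; ring

/-- `n(x, 1) = t(x)`. [cite: Runge1999EndomorphismRingsAbelianSurfaces, §6 p. 294] -/
theorem rungeNormPolar_one_right (x : 𝕄) : rungeNormPolar x 1 = rungeTrace x := by
  rw [rungeNormPolar_eq, rungeTrace_one, mul_one]; ring

/-- `n(1) = 1`. [cite: Runge1999EndomorphismRingsAbelianSurfaces, §6 p. 294] -/
theorem rungeNorm_one : rungeNorm (1 : 𝕄) = 1 := by
  rw [rungeNorm, one_mul, rungeTrace_one]; norm_num

/-- **Runge's discriminant `Δ(x) = t(x)² − 4n(x)`.** [cite: Runge1999EndomorphismRingsAbelianSurfaces, §6 p. 294] -/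
def rungeDisc (x : 𝕄) : ℚ := rungeTrace x ^ 2 - 4 * rungeNorm x

/-- `Δ(x) = 2t(x²) − t(x)²`. [cite: Runge1999EndomorphismRingsAbelianSurfaces, §6 p. 294] -/
theorem rungeDisc_eq (x : 𝕄) : rungeDisc x = 2 * rungeTrace (x * x) - rungeTrace x ^ 2 := by
  rw [rungeDisc, rungeNorm]; ring

/-- **Runge's discriminant form `Δ(x, y) = ½(Δ(x + y) − Δ(x) − Δ(y))`.** [cite: Runge1999EndomorphismRingsAbelianSurfaces, §6 p. 294] -/
def rungeDiscPolar (x y : 𝕄) : ℚ := (rungeDisc (x + y) - rungeDisc x - rungeDisc y) / 2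

/-- **`Δ(x, y) = 2t(xy) − t(x)t(y)`.** [cite: Runge1999EndomorphismRingsAbelianSurfaces, §6 p. 294] -/
theorem rungeDiscPolar_eq_two_mul_sub (x y : 𝕄) :
    rungeDiscPolar x y = 2 * rungeTrace (x * y) - rungeTrace x * rungeTrace y := by
  simp only [rungeDiscPolar, rungeDisc_eq, map_add, add_mul, mul_add, rungeTrace_mul_comm y x]
  ring

/-- **`Δ(x, y) = t(x)t(y) − 2n(x, y)`.** [cite: Runge1999EndomorphismRingsAbelianSurfaces, §6 p. 294] -/
theorem rungeDiscPolar_eq_sub_two_mul (x y : 𝕄) :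
    rungeDiscPolar x y = rungeTrace x * rungeTrace y - 2 * rungeNormPolar x y := by
  rw [rungeDiscPolar_eq_two_mul_sub, rungeNormPolar_eq]; ring

/-- `Δ(x, x) = Δ(x)`. [cite: Runge1999EndomorphismRingsAbelianSurfaces, §6 p. 294] -/
theorem rungeDiscPolar_self (x : 𝕄) : rungeDiscPolar x x = rungeDisc x := by
  rw [rungeDiscPolar_eq_two_mul_sub, rungeDisc_eq]; ring

/-- `Δ(x, y) = Δ(y, x)`. [cite: Runge1999EndomorphismRingsAbelianSurfaces, §6 p. 294] -/
theorem rungeDiscPolar_comm (x y : 𝕄) : rungeDiscPolar x y = rungeDiscPolar y x := by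
  rw [rungeDiscPolar_eq_two_mul_sub, rungeDiscPolar_eq_two_mul_sub, rungeTrace_mul_comm, mul_comm (rungeTrace x)]

/-- **"The discriminant form is identically zero on `ℚ`"**: `Δ(c·1, y) = 0`. [cite: Runge1999EndomorphismRingsAbelianSurfaces, §6 p. 294] -/
theorem rungeDiscPolar_smul_one_left (c : ℚ) (y : 𝕄) : rungeDiscPolar (c • (1 : 𝕄)) y = 0 := by
  rw [rungeDiscPolar_eq_two_mul_sub, smul_mul_assoc, one_mul, map_smul, rungeTrace_smul_one, smul_eq_mul]; ring

/-- "… and hence determines a ternary quadratic form on `A/ℚ`": `Δ(x + c·1) = Δ(x)`.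
[cite: Runge1999EndomorphismRingsAbelianSurfaces, §6 p. 294] -/
theorem rungeDisc_add_smul_one (x : 𝕄) (c : ℚ) : rungeDisc (x + c • (1 : 𝕄)) = rungeDisc x := by
  have h : rungeDisc (x + c • (1 : 𝕄)) = rungeDisc x + 2 * rungeDiscPolar x (c • 1) + rungeDisc (c • (1 : 𝕄)) := by
    rw [rungeDiscPolar]; ring
  have h1 : rungeDisc (c • (1 : 𝕄)) = 0 := by
    rw [← rungeDiscPolar_self, rungeDiscPolar_smul_one_left]
  rw [h, rungeDiscPolar_comm, rungeDiscPolar_smul_one_left, h1]; ring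

end TraceCalculus

/-! ## §2 The dictionary with row A4-66 FILE 1 (`redTrace`, `redNorm`, `redNormPolar`, `humbertPolar`) -/

section Dictionary

variable (q q' : Fin 5 → ℤ)

/-- **`t(R₀(q)) = b`** (`Tr(R₀(q)) = 2b` is row A4-59‴'s `trace_humbertRatRep`). [cite: Runge1999EndomorphismRingsAbelianSurfaces, §4 p. 288] [cite: BirkenhakeWilhelm2003, §4 Prop. 4.3 (p. 1827)] -/
theorem rungeTrace_map_humbertRatRep : rungeTrace ((humbertRatRep q).map (Int.cast : ℤ → ℚ)) = q 1 := by
  rw [rungeTrace_apply, trace_castQ, trace_humbertRatRep]; push_cast; ring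

/-- **`t(X(m, q)) = 2m + b = redTrace m q`.** [cite: Runge1999EndomorphismRingsAbelianSurfaces, §4 p. 288 ("`t(M) = Tr(A)`")] -/
theorem rungeTrace_map_rosatiMatrix (m : ℤ) :
    rungeTrace ((rosatiMatrix m q).map (Int.cast : ℤ → ℚ)) = redTrace m q := by
  rw [rungeTrace_apply, trace_castQ, trace_rosatiMatrix_eq_two_mul_redTrace]; push_cast; ring

/-- **`n(X(m, q)) = m² + mb + (ac + de) = redNorm m q`.** [cite: Runge1999EndomorphismRingsAbelianSurfaces, §4 p. 288 ("`M² − Tr(A)M + det(A) + bc = 0`")] -/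
theorem rungeNorm_map_rosatiMatrix (m : ℤ) :
    rungeNorm ((rosatiMatrix m q).map (Int.cast : ℤ → ℚ)) = redNorm m q := by
  have hsq := congrArg (fun A : Matrix (Fin 2 ⊕ Fin 2) (Fin 2 ⊕ Fin 2) ℤ ↦ A.map (Int.cast : ℤ → ℚ))
    (rosatiMatrix_mul_self m q)
  simp only [castQ_mul, castQ_sub, castQ_smul, castQ_one] at hsq
  rw [rungeNorm, hsq, map_sub, map_smul, map_smul, rungeTrace_map_rosatiMatrix, rungeTrace_one, smul_eq_mul,
    smul_eq_mul]
  ring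

/-- **`Δ(X(m, q)) = humbertInvariant q`** (Humbert's invariant `b² − 4ac − 4de`). [cite: Runge1999EndomorphismRingsAbelianSurfaces, §4 p. 288 ("`Δ(M) = Tr(A)² − 4(det(A) + bc)`")] -/
theorem rungeDisc_map_rosatiMatrix (m : ℤ) :
    rungeDisc ((rosatiMatrix m q).map (Int.cast : ℤ → ℚ)) = humbertInvariant q := by
  rw [rungeDisc, rungeTrace_map_rosatiMatrix, rungeNorm_map_rosatiMatrix, ← redTrace_sq_sub_four_mul_redNorm m q]
  push_cast; ring

/-- **`n(X(m,q), X(n,q′)) = redNormPolar m q n q′`** (`= 2mn + mb′ + nb + (ac′ + a′c + de′ + d′e)`), from Lemma 8.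
[cite: Runge1999EndomorphismRingsAbelianSurfaces, §6 p. 294 and Lemma 8 (p. 295)] -/
theorem rungeNormPolar_map_rosatiMatrix (m n : ℤ) :
    rungeNormPolar ((rosatiMatrix m q).map (Int.cast : ℤ → ℚ)) ((rosatiMatrix n q').map (Int.cast : ℤ → ℚ)) =
      redNormPolar m q n q' := by
  have h8 := congrArg (fun A : Matrix (Fin 2 ⊕ Fin 2) (Fin 2 ⊕ Fin 2) ℤ ↦ rungeTrace (A.map (Int.cast : ℤ → ℚ)))
    (rosatiMatrix_mul_add_mul m q n q')
  simp only [castQ_mul, castQ_add, castQ_sub, castQ_smul, castQ_one, map_add, map_sub, map_smul,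
    rungeTrace_map_rosatiMatrix, rungeTrace_one, smul_eq_mul] at h8
  rw [rungeTrace_mul_comm ((rosatiMatrix n q').map _)] at h8
  rw [rungeNormPolar_eq, rungeTrace_map_rosatiMatrix, rungeTrace_map_rosatiMatrix]
  linarith

/-- **The discriminant form is Humbert's polar form: `Δ(X(m,q), X(n,q′)) = humbertPolar q q′`**
(`= bb′ − 2(ac′ + a′c) − 2(de′ + d′e)`, independent of the trace parameters).
[cite: Runge1999EndomorphismRingsAbelianSurfaces, §6 p. 294 ("`Δ(x, y) = t(x)t(y) − 2n(x, y)`")] -/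
theorem rungeDiscPolar_map_rosatiMatrix (m n : ℤ) :
    rungeDiscPolar ((rosatiMatrix m q).map (Int.cast : ℤ → ℚ)) ((rosatiMatrix n q').map (Int.cast : ℤ → ℚ)) =
      humbertPolar q q' := by
  rw [rungeDiscPolar_eq_sub_two_mul, rungeNormPolar_map_rosatiMatrix, rungeTrace_map_rosatiMatrix,
    rungeTrace_map_rosatiMatrix, ← redTrace_mul_sub_two_mul_redNormPolar m q n q']
  push_cast; ring

end Dictionary

/-! ## §3 The anticommutators of `(1, α, β, αβ)` over `ℤ` and `γ² = ¼(Δ(q,q′)² − Δ(q)Δ(q′))·1` -/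

section Integer

variable (q q' : Fin 5 → ℤ)

/-- **`α(αβ) + (αβ)α = t(α)·αβ + t(αβ)·α − n(α, αβ)·1`** with `t(αβ) = bb′ − N(q,q′)`, `n(α, αβ) = t(β)n(α) = b′(ac + de)`
(Lemma 8's identity for the pair `(α, αβ)`, `α = R₀(q)`, `β = R₀(q′)`; a routine `4 × 4` calculation).
[cite: Runge1999EndomorphismRingsAbelianSurfaces, §6 p. 294 and Lemma 8 (p. 295)] -/
theorem humbertRatRep_mul_pair_add_pair_mul :
    humbertRatRep q * (humbertRatRep q * humbertRatRep q') + (humbertRatRep q * humbertRatRep q') * humbertRatRep q =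
      q 1 • (humbertRatRep q * humbertRatRep q') + (q 1 * q' 1 - humbertNormPolar q q') • humbertRatRep q -
        (q' 1 * humbertNormTerm q) • (1 : Matrix _ _ ℤ) := by
  ext i j
  rcases i with i | i <;> rcases j with j | j <;> fin_cases i <;> fin_cases j <;>
    simp only [Matrix.mul_apply, Matrix.add_apply, Matrix.sub_apply, Matrix.smul_apply, Matrix.one_apply,
      smul_eq_mul, Fintype.sum_sum_type, Fin.sum_univ_two] <;>
    simp [humbertRatRep, humbertNormPolar, humbertNormTerm] <;> ring

/-- **`β(αβ) + (αβ)β = t(β)·αβ + t(αβ)·β − n(β, αβ)·1`** with `n(β, αβ) = t(α)n(β) = b(a′c′ + d′e′)`.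
[cite: Runge1999EndomorphismRingsAbelianSurfaces, §6 p. 294 and Lemma 8 (p. 295)] -/
theorem humbertRatRep_mul_pair_add_pair_mul' :
    humbertRatRep q' * (humbertRatRep q * humbertRatRep q') + (humbertRatRep q * humbertRatRep q') * humbertRatRep q' =
      q' 1 • (humbertRatRep q * humbertRatRep q') + (q 1 * q' 1 - humbertNormPolar q q') • humbertRatRep q' -
        (q 1 * humbertNormTerm q') • (1 : Matrix _ _ ℤ) := by
  ext i j
  rcases i with i | i <;> rcases j with j | j <;> fin_cases i <;> fin_cases j <;>
    simp only [Matrix.mul_apply, Matrix.add_apply, Matrix.sub_apply, Matrix.smul_apply, Matrix.one_apply,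
      smul_eq_mul, Fintype.sum_sum_type, Fin.sum_univ_two] <;>
    simp [humbertRatRep, humbertNormPolar, humbertNormTerm] <;> ring

/-- **`(αβ)² = t(αβ)·αβ − n(αβ)·1` with `n(αβ) = n(α)n(β) = (ac + de)(a′c′ + d′e′)`** ("the map `n : A → ℚ` is
multiplicative"). [cite: Runge1999EndomorphismRingsAbelianSurfaces, §6 p. 294] -/
theorem humbertRatRep_pair_mul_pair :
    (humbertRatRep q * humbertRatRep q') * (humbertRatRep q * humbertRatRep q') =
      (q 1 * q' 1 - humbertNormPolar q q') • (humbertRatRep q * humbertRatRep q') -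
        (humbertNormTerm q * humbertNormTerm q') • (1 : Matrix _ _ ℤ) := by
  ext i j
  rcases i with i | i <;> rcases j with j | j <;> fin_cases i <;> fin_cases j <;>
    simp only [Matrix.mul_apply, Matrix.sub_apply, Matrix.smul_apply, Matrix.one_apply,
      smul_eq_mul, Fintype.sum_sum_type, Fin.sum_univ_two] <;>
    simp [humbertRatRep, humbertNormPolar, humbertNormTerm] <;> ring

/-- **Runge's `γ² = (Δ(α,β)² − Δ(α)Δ(β))/4` as an INTEGER**: in the letters `b = t(α)`, `N = n(α)`, `b′`, `N′`,
`ν = N(q,q′)` it is `ν² − νbb′ + N′b² + Nb′² − 4NN′` (`four_mul_gammaSq`, `humbertComm_mul_self`); `−gammaSq = det S_Δ/4`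
is the discriminant `d(R)` of Theorem 7. [cite: Runge1999EndomorphismRingsAbelianSurfaces, §6 proof of Thm. 7 (p. 295)] -/
def gammaSq (q q' : Fin 5 → ℤ) : ℤ :=
  humbertNormPolar q q' ^ 2 - humbertNormPolar q q' * q 1 * q' 1 + humbertNormTerm q' * q 1 ^ 2 +
    humbertNormTerm q * q' 1 ^ 2 - 4 * humbertNormTerm q * humbertNormTerm q'

/-- **`4γ² = Δ(q,q′)² − Δ(q)Δ(q′) = −det S_Δ`.** [cite: Runge1999EndomorphismRingsAbelianSurfaces, §6 proof of Thm. 7 (p. 295)] -/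
theorem four_mul_gammaSq : 4 * gammaSq q q' = humbertPolar q q' ^ 2 - humbertInvariant q * humbertInvariant q' := by
  rw [gammaSq, humbertPolar_eq_mul_sub_two_mul_humbertNormPolar]
  simp only [humbertInvariant, humbertNormTerm]
  ring

/-- `gammaSq` is symmetric. [cite: Runge1999EndomorphismRingsAbelianSurfaces, §6 proof of Thm. 7 (p. 295)] -/
theorem gammaSq_comm : gammaSq q q' = gammaSq q' q := by
  simp only [gammaSq, humbertNormPolar_comm q' q]; ring

/-- **`γ² = gammaSq·1`** (Runge's "`γ² = −n(γ) = (Δ(α, β)² − Δ(α)Δ(β))/4`", the division by `4` performed in `M₄(ℤ)`).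
[cite: Runge1999EndomorphismRingsAbelianSurfaces, §6 proof of Thm. 7 (p. 295)] -/
theorem humbertComm_mul_self : humbertComm q q' * humbertComm q q' = gammaSq q q' • (1 : Matrix _ _ ℤ) := by
  have h4 := four_smul_humbertComm_mul_self q q'
  rw [← four_mul_gammaSq, ← smul_smul] at h4
  exact smul_right_injective (Matrix (Fin 2 ⊕ Fin 2) (Fin 2 ⊕ Fin 2) ℤ) (by norm_num : (4 : ℤ) ≠ 0) h4

/-- `4 ∣ Δ(q)Δ(q′) − Δ(q,q′)² = det S_Δ` (so `det S_Δ/4 = −gammaSq` is an integer).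
[cite: Runge1999EndomorphismRingsAbelianSurfaces, §6 Thm. 7 (p. 295: "`d(R) = det(S_Δ)/4`")] -/
theorem four_dvd_det_discMatrix' : (4 : ℤ) ∣ humbertInvariant q * humbertInvariant q' - humbertPolar q q' ^ 2 :=
  ⟨-gammaSq q q', by rw [mul_neg, four_mul_gammaSq]; ring⟩

end Integer

/-! ## §4 "Any element satisfies `x² − t(x)x + n(x) = 0`" on `ℚ(α, β)` -/

section Quadratic

variable (q q' : Fin 5 → ℤ)

/-- `α = R₀(q)` over `ℚ`. -/
local notation "α" => Matrix.map (humbertRatRep q) (Int.cast : ℤ → ℚ)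
/-- `β = R₀(q′)` over `ℚ`. -/
local notation "β" => Matrix.map (humbertRatRep q') (Int.cast : ℤ → ℚ)

/-- **The spanning family `(1, α, β, αβ)` of `ℚ(α, β)`** (`α = R₀(q)`, `β = R₀(q′)` over `ℚ`), Runge's basis of
`R ⊗ ℚ = ℚ ⊕ ℚα ⊕ ℚβ ⊕ ℚαβ`. [cite: Runge1999EndomorphismRingsAbelianSurfaces, §6 Thm. 7 and its proof (p. 295)] -/
def humbertPairFam (q q' : Fin 5 → ℤ) : Fin 4 → 𝕄 :=
  ![1, (humbertRatRep q).map (Int.cast : ℤ → ℚ), (humbertRatRep q').map (Int.cast : ℤ → ℚ),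
    (humbertRatRep q).map (Int.cast : ℤ → ℚ) * (humbertRatRep q').map (Int.cast : ℤ → ℚ)]

/-- `x₁ = 1`. [folklore] -/
@[simp] private theorem humbertPairFam_zero : humbertPairFam q q' 0 = 1 := rfl
/-- `x₂ = α`. [folklore] -/
@[simp] private theorem humbertPairFam_one : humbertPairFam q q' 1 = α := rfl
/-- `x₃ = β`. [folklore] -/
@[simp] private theorem humbertPairFam_two : humbertPairFam q q' 2 = β := rfl
/-- `x₄ = αβ`. [folklore] -/
@[simp] private theorem humbertPairFam_three : humbertPairFam q q' 3 = α * β := rfl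

/-- The range of the family is the printed spanning set `{1, α, β, αβ}`. [cite: Runge1999EndomorphismRingsAbelianSurfaces, §6 proof of Thm. 7 (p. 295)] -/
theorem range_humbertPairFam : Set.range (humbertPairFam q q') = {1, α, β, α * β} := by
  ext x
  simp only [Set.mem_range, Set.mem_insert_iff, Set.mem_singleton_iff]
  constructor
  · rintro ⟨i, rfl⟩; fin_cases i <;> simp [humbertPairFam]
  · rintro (rfl | rfl | rfl | rfl)
    · exact ⟨0, rfl⟩
    · exact ⟨1, rfl⟩
    · exact ⟨2, rfl⟩
    · exact ⟨3, rfl⟩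

/-- **`ℚ(α, β)` is the span of the family `(1, α, β, αβ)`** (row A4-66 FILE 2, restated on the indexed family).
[cite: Runge1999EndomorphismRingsAbelianSurfaces, §6 proof of Thm. 7 (p. 295: "`R ⊗ ℚ = ℚ ⊕ ℚα ⊕ ℚβ ⊕ ℚαβ`")] -/
theorem span_range_humbertPairFam :
    Submodule.span ℚ (Set.range (humbertPairFam q q')) = Subalgebra.toSubmodule (humbertPairAlg q q') := by
  rw [range_humbertPairFam, humbertPairAlg_toSubmodule_eq_span]

/-- The trace table, I: `t(α²) = b² − 2(ac + de)`. [cite: Runge1999EndomorphismRingsAbelianSurfaces, §6 p. 294] -/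
theorem rungeTrace_alpha_sq : rungeTrace (α * α) = (q 1 : ℚ) ^ 2 - 2 * humbertNormTerm q := by
  have h := congrArg (fun A : Matrix (Fin 2 ⊕ Fin 2) (Fin 2 ⊕ Fin 2) ℤ ↦ rungeTrace (A.map (Int.cast : ℤ → ℚ)))
    (humbertRatRep_mul_self q)
  simp only [castQ_mul, castQ_sub, castQ_smul, castQ_one, map_sub, map_smul, rungeTrace_map_humbertRatRep,
    rungeTrace_one, smul_eq_mul] at h
  rw [h, humbertNormTerm]; push_cast; ring

/-- The trace table, II: **`t(αβ) = bb′ − N(q, q′)`** (trace of Lemma 8). [cite: Runge1999EndomorphismRingsAbelianSurfaces, §6 Lemma 8 (p. 295)] -/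
theorem rungeTrace_pair : rungeTrace (α * β) = (q 1 : ℚ) * q' 1 - humbertNormPolar q q' := by
  have h := congrArg rungeTrace (humbertRatRep_map_mul_add_mul q q')
  simp only [map_add, map_sub, map_smul, rungeTrace_map_humbertRatRep, rungeTrace_one, smul_eq_mul] at h
  rw [rungeTrace_mul_comm β] at h
  linarith

/-- The trace table, III: `t(α·αβ) = b·t(αβ) − b′(ac + de)`. [cite: Runge1999EndomorphismRingsAbelianSurfaces, §6 p. 294] -/
theorem rungeTrace_alpha_pair :
    rungeTrace (α * (α * β)) = (q 1 : ℚ) * ((q 1 : ℚ) * q' 1 - humbertNormPolar q q') - q' 1 * humbertNormTerm q := by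
  have h := congrArg (fun A : Matrix (Fin 2 ⊕ Fin 2) (Fin 2 ⊕ Fin 2) ℤ ↦ rungeTrace (A.map (Int.cast : ℤ → ℚ)))
    (humbertRatRep_mul_pair_add_pair_mul q q')
  simp only [castQ_mul, castQ_add, castQ_sub, castQ_smul, castQ_one, map_add, map_sub, map_smul,
    rungeTrace_map_humbertRatRep, rungeTrace_one, smul_eq_mul, rungeTrace_pair] at h
  rw [rungeTrace_mul_comm (α * β) α] at h
  push_cast at h ⊢
  linarith

/-- The trace table, IV: `t(β·αβ) = b′·t(αβ) − b(a′c′ + d′e′)`. [cite: Runge1999EndomorphismRingsAbelianSurfaces, §6 p. 294] -/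
theorem rungeTrace_beta_pair :
    rungeTrace (β * (α * β)) = (q' 1 : ℚ) * ((q 1 : ℚ) * q' 1 - humbertNormPolar q q') - q 1 * humbertNormTerm q' := by
  have h := congrArg (fun A : Matrix (Fin 2 ⊕ Fin 2) (Fin 2 ⊕ Fin 2) ℤ ↦ rungeTrace (A.map (Int.cast : ℤ → ℚ)))
    (humbertRatRep_mul_pair_add_pair_mul' q q')
  simp only [castQ_mul, castQ_add, castQ_sub, castQ_smul, castQ_one, map_add, map_sub, map_smul,
    rungeTrace_map_humbertRatRep, rungeTrace_one, smul_eq_mul, rungeTrace_pair] at h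
  rw [rungeTrace_mul_comm (α * β) β] at h
  push_cast at h ⊢
  linarith

/-- The trace table, V: `t((αβ)²) = t(αβ)² − 2n(α)n(β)`. [cite: Runge1999EndomorphismRingsAbelianSurfaces, §6 p. 294] -/
theorem rungeTrace_pair_sq :
    rungeTrace ((α * β) * (α * β)) =
      ((q 1 : ℚ) * q' 1 - humbertNormPolar q q') ^ 2 - 2 * (humbertNormTerm q * humbertNormTerm q' : ℤ) := by
  have h := congrArg (fun A : Matrix (Fin 2 ⊕ Fin 2) (Fin 2 ⊕ Fin 2) ℤ ↦ rungeTrace (A.map (Int.cast : ℤ → ℚ)))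
    (humbertRatRep_pair_mul_pair q q')
  simp only [castQ_mul, castQ_sub, castQ_smul, castQ_one, map_sub, map_smul, rungeTrace_one, smul_eq_mul,
    rungeTrace_pair] at h
  push_cast at h ⊢
  linarith

/-- The symmetric bilinear defect `S(x, y) := xy + yx − t(x)y − t(y)x + n(x, y)·1` (vanishes on `ℚ(α, β)`). [folklore] -/
private def quadDefect (x y : 𝕄) : 𝕄 :=
  x * y + y * x - rungeTrace x • y - rungeTrace y • x + (rungeTrace x * rungeTrace y - rungeTrace (x * y)) • (1 : 𝕄)

/-- `S` is symmetric. [folklore] -/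
private theorem quadDefect_comm (x y : 𝕄) : quadDefect x y = quadDefect y x := by
  simp only [quadDefect, rungeTrace_mul_comm x y, mul_comm (rungeTrace x)]; abel

/-- `S` is additive in the first slot. [folklore] -/
private theorem quadDefect_add_left (x₁ x₂ y : 𝕄) : quadDefect (x₁ + x₂) y = quadDefect x₁ y + quadDefect x₂ y := by
  simp only [quadDefect, add_mul, mul_add, map_add, add_smul, smul_add, sub_smul]
  module

/-- `S` is homogeneous in the first slot. [folklore] -/
private theorem quadDefect_smul_left (c : ℚ) (x y : 𝕄) : quadDefect (c • x) y = c • quadDefect x y := by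
  simp only [quadDefect, smul_mul_assoc, mul_smul_comm, map_smul, smul_eq_mul, smul_sub, smul_add, smul_smul]
  module

/-- `S(0, y) = 0`. [folklore] -/
private theorem quadDefect_zero_left (y : 𝕄) : quadDefect 0 y = 0 := by
  simp [quadDefect]

/-- `S(1, y) = 0` for every `y`. [folklore] -/
private theorem quadDefect_one_left (y : 𝕄) : quadDefect 1 y = 0 := by
  simp only [quadDefect, one_mul, mul_one, rungeTrace_one]
  module

/-- `S(α, α) = 0` (`α² = bα − (ac+de)·1`). [folklore] -/
private theorem quadDefect_alpha_alpha : quadDefect α α = 0 := by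
  have hsq := humbertRatRep_map_mul_self q
  simp only [quadDefect, rungeTrace_map_humbertRatRep, rungeTrace_alpha_sq]
  rw [hsq]
  push_cast
  module

/-- `S(β, β) = 0`. [folklore] -/
private theorem quadDefect_beta_beta : quadDefect β β = 0 := by
  have hsq := humbertRatRep_map_mul_self q'
  have ht : rungeTrace (β * β) = (q' 1 : ℚ) ^ 2 - 2 * humbertNormTerm q' := rungeTrace_alpha_sq q'
  simp only [quadDefect, rungeTrace_map_humbertRatRep, ht]
  rw [hsq]
  push_cast
  module

/-- `S(α, β) = 0` (Lemma 8). [folklore] -/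
private theorem quadDefect_alpha_beta : quadDefect α β = 0 := by
  have h8 := humbertRatRep_map_mul_add_mul q q'
  simp only [quadDefect, rungeTrace_map_humbertRatRep, rungeTrace_pair]
  rw [show α * β + β * α - (q 1 : ℚ) • β - (q' 1 : ℚ) • α = -((humbertNormPolar q q' : ℚ) • (1 : 𝕄)) by
    rw [h8]; module]
  module

/-- `S(α, αβ) = 0`. [folklore] -/
private theorem quadDefect_alpha_pair : quadDefect α (α * β) = 0 := by
  have h := congrArg (fun A : Matrix (Fin 2 ⊕ Fin 2) (Fin 2 ⊕ Fin 2) ℤ ↦ A.map (Int.cast : ℤ → ℚ))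
    (humbertRatRep_mul_pair_add_pair_mul q q')
  simp only [castQ_mul, castQ_add, castQ_sub, castQ_smul, castQ_one] at h
  simp only [quadDefect, rungeTrace_map_humbertRatRep, rungeTrace_pair, rungeTrace_alpha_pair]
  rw [show α * (α * β) + α * β * α = (q 1 : ℚ) • (α * β) + ((q 1 * q' 1 - humbertNormPolar q q' : ℤ) : ℚ) • α -
      ((q' 1 * humbertNormTerm q : ℤ) : ℚ) • (1 : 𝕄) from h]
  push_cast
  module

/-- `S(β, αβ) = 0`. [folklore] -/
private theorem quadDefect_beta_pair : quadDefect β (α * β) = 0 := by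
  have h := congrArg (fun A : Matrix (Fin 2 ⊕ Fin 2) (Fin 2 ⊕ Fin 2) ℤ ↦ A.map (Int.cast : ℤ → ℚ))
    (humbertRatRep_mul_pair_add_pair_mul' q q')
  simp only [castQ_mul, castQ_add, castQ_sub, castQ_smul, castQ_one] at h
  simp only [quadDefect, rungeTrace_map_humbertRatRep, rungeTrace_pair, rungeTrace_beta_pair]
  rw [show β * (α * β) + α * β * β = (q' 1 : ℚ) • (α * β) + ((q 1 * q' 1 - humbertNormPolar q q' : ℤ) : ℚ) • β -
      ((q 1 * humbertNormTerm q' : ℤ) : ℚ) • (1 : 𝕄) from h]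
  push_cast
  module

/-- `S(αβ, αβ) = 0`. [folklore] -/
private theorem quadDefect_pair_pair : quadDefect (α * β) (α * β) = 0 := by
  have h := congrArg (fun A : Matrix (Fin 2 ⊕ Fin 2) (Fin 2 ⊕ Fin 2) ℤ ↦ A.map (Int.cast : ℤ → ℚ))
    (humbertRatRep_pair_mul_pair q q')
  simp only [castQ_mul, castQ_sub, castQ_smul, castQ_one] at h
  simp only [quadDefect, rungeTrace_pair, rungeTrace_pair_sq]
  rw [show α * β * (α * β) = ((q 1 * q' 1 - humbertNormPolar q q' : ℤ) : ℚ) • (α * β) -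
      ((humbertNormTerm q * humbertNormTerm q' : ℤ) : ℚ) • (1 : 𝕄) from h]
  push_cast
  module

/-- `S` vanishes on all pairs of the spanning family. [folklore] -/
private theorem quadDefect_humbertPairFam (i j : Fin 4) : quadDefect (humbertPairFam q q' i) (humbertPairFam q q' j) = 0 := by
  fin_cases i <;> fin_cases j
  all_goals simp only [humbertPairFam_zero, humbertPairFam_one, humbertPairFam_two, humbertPairFam_three,
    Fin.zero_eta, Fin.mk_one, Fin.reduceFinMk]
  · exact quadDefect_one_left 1
  · exact quadDefect_one_left _
  · exact quadDefect_one_left _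
  · exact quadDefect_one_left _
  · rw [quadDefect_comm]; exact quadDefect_one_left _
  · exact quadDefect_alpha_alpha q
  · exact quadDefect_alpha_beta q q'
  · exact quadDefect_alpha_pair q q'
  · rw [quadDefect_comm]; exact quadDefect_one_left _
  · rw [quadDefect_comm]; exact quadDefect_alpha_beta q q'
  · exact quadDefect_beta_beta q'
  · exact quadDefect_beta_pair q q'
  · rw [quadDefect_comm]; exact quadDefect_one_left _
  · rw [quadDefect_comm]; exact quadDefect_alpha_pair q q'
  · rw [quadDefect_comm]; exact quadDefect_beta_pair q q'
  · exact quadDefect_pair_pair q q'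

/-- `S(x, y) = 0` for `x, y` in the span of the family (bilinearity). [folklore] -/
private theorem quadDefect_eq_zero_of_mem_span {x y : 𝕄}
    (hx : x ∈ Submodule.span ℚ (Set.range (humbertPairFam q q')))
    (hy : y ∈ Submodule.span ℚ (Set.range (humbertPairFam q q'))) : quadDefect x y = 0 := by
  induction hx using Submodule.span_induction with
  | mem x hx =>
    obtain ⟨i, rfl⟩ := hx
    induction hy using Submodule.span_induction with
    | mem y hy => obtain ⟨j, rfl⟩ := hy; exact quadDefect_humbertPairFam q q' i j
    | zero => rw [quadDefect_comm]; exact quadDefect_zero_left _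
    | add y₁ y₂ _ _ h₁ h₂ => rw [quadDefect_comm, quadDefect_add_left, quadDefect_comm y₁, quadDefect_comm y₂, h₁, h₂, add_zero]
    | smul c y _ h => rw [quadDefect_comm, quadDefect_smul_left, quadDefect_comm y, h, smul_zero]
  | zero => exact quadDefect_zero_left _
  | add x₁ x₂ _ _ h₁ h₂ => rw [quadDefect_add_left, h₁, h₂, add_zero]
  | smul c x _ h => rw [quadDefect_smul_left, h, smul_zero]

variable {q q'}

/-- **LEMMA 8's identity for ALL pairs of elements of `ℚ(α, β)`: `xy + yx = t(x)y + t(y)x − n(x, y)·1`.**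
[cite: Runge1999EndomorphismRingsAbelianSurfaces, §6 p. 294 ("`n(x, y) = … = xȳ + yx̄`") and Lemma 8 (p. 295)] -/
theorem mul_add_mul_eq_of_mem {x y : 𝕄} (hx : x ∈ humbertPairAlg q q') (hy : y ∈ humbertPairAlg q q') :
    x * y + y * x = rungeTrace x • y + rungeTrace y • x - rungeNormPolar x y • (1 : 𝕄) := by
  have hx' : x ∈ Submodule.span ℚ (Set.range (humbertPairFam q q')) := by
    rw [span_range_humbertPairFam]; exact hx
  have hy' : y ∈ Submodule.span ℚ (Set.range (humbertPairFam q q')) := by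
    rw [span_range_humbertPairFam]; exact hy
  have h := quadDefect_eq_zero_of_mem_span q q' hx' hy'
  rw [quadDefect] at h
  rw [rungeNormPolar_eq, ← sub_eq_zero, ← h]
  abel

/-- **"In a rational quaternion algebra `A` any element satisfies an equation `x² − t(x)x + n(x) = 0`"** — here for
`A = ℚ(α, β)`, `t = ½·Tr`, `n(x) = ½(t(x)² − t(x²))`. [cite: Runge1999EndomorphismRingsAbelianSurfaces, §6 p. 294] -/
theorem mul_self_sub_rungeTrace_smul_add {x : 𝕄} (hx : x ∈ humbertPairAlg q q') :
    x * x - rungeTrace x • x + rungeNorm x • (1 : 𝕄) = 0 := by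
  have h := mul_add_mul_eq_of_mem hx hx
  rw [rungeNormPolar_self] at h
  have h2 : (2 : ℚ) • (x * x - rungeTrace x • x + rungeNorm x • (1 : 𝕄)) = 0 := by
    rw [show (2 : ℚ) • (x * x - rungeTrace x • x + rungeNorm x • (1 : 𝕄)) =
      (x * x + x * x) - (rungeTrace x • x + rungeTrace x • x - (2 * rungeNorm x) • (1 : 𝕄)) by module, h, sub_self]
  exact (smul_eq_zero_iff_right (by norm_num : (2 : ℚ) ≠ 0)).1 h2

/-- **`x x̄ = n(x)·1` with the "main anti-involution `x̄ = t(x) − x`"**, for `x ∈ ℚ(α, β)`.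
[cite: Runge1999EndomorphismRingsAbelianSurfaces, §6 p. 294 ("`n(x, x) = 2n(x) = 2xx̄`")] -/
theorem mul_rungeBar_of_mem {x : 𝕄} (hx : x ∈ humbertPairAlg q q') :
    x * (rungeTrace x • (1 : 𝕄) - x) = rungeNorm x • (1 : 𝕄) := by
  have h := mul_self_sub_rungeTrace_smul_add hx
  rw [mul_sub, mul_smul_comm, mul_one, ← sub_eq_zero,
    show rungeTrace x • x - x * x - rungeNorm x • (1 : 𝕄) = -(x * x - rungeTrace x • x + rungeNorm x • (1 : 𝕄)) by abel,
    h, neg_zero]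

/-- `x̄ x = n(x)·1` as well. [cite: Runge1999EndomorphismRingsAbelianSurfaces, §6 p. 294] -/
theorem rungeBar_mul_of_mem {x : 𝕄} (hx : x ∈ humbertPairAlg q q') :
    (rungeTrace x • (1 : 𝕄) - x) * x = rungeNorm x • (1 : 𝕄) := by
  have h := mul_self_sub_rungeTrace_smul_add hx
  rw [sub_mul, smul_mul_assoc, one_mul, ← sub_eq_zero,
    show rungeTrace x • x - x * x - rungeNorm x • (1 : 𝕄) = -(x * x - rungeTrace x • x + rungeNorm x • (1 : 𝕄)) by abel,
    h, neg_zero]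

end Quadratic

/-! ## §5 The trace form `(t(xᵢxⱼ))`, the discriminant `d² = −det(t(xᵢxⱼ))` and independence of `1, α, β, αβ` -/

section Discriminant

/-- **The Gram matrix `(t(xᵢxⱼ))` of the trace form on four elements of `M₄(ℚ)`.**
[cite: Runge1999EndomorphismRingsAbelianSurfaces, §6 p. 294 ("`d(x₁, x₂, x₃, x₄)² = −det(t(xᵢxⱼ))`")] -/
def traceGram (x : Fin 4 → 𝕄) : Matrix (Fin 4) (Fin 4) ℚ := Matrix.of fun i j ↦ rungeTrace (x i * x j)

/-- Entries of `traceGram`. [cite: Runge1999EndomorphismRingsAbelianSurfaces, §6 p. 294] -/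
@[simp] theorem traceGram_apply (x : Fin 4 → 𝕄) (i j : Fin 4) : traceGram x i j = rungeTrace (x i * x j) := rfl

/-- The Gram matrix is symmetric (`t(xy) = t(yx)`). [cite: Runge1999EndomorphismRingsAbelianSurfaces, §6 p. 294] -/
theorem traceGram_transpose (x : Fin 4 → 𝕄) : (traceGram x)ᵀ = traceGram x := by
  ext i j; simp [rungeTrace_mul_comm (x j)]

/-- **Runge's discriminant squared `d(x₁, x₂, x₃, x₄)² := −det(t(xᵢxⱼ))`** of the module generated by `x₁, …, x₄`
("we always choose the positive sign" for `d` itself). [cite: Runge1999EndomorphismRingsAbelianSurfaces, §6 p. 294] -/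
def rungeDiscrSq (x : Fin 4 → 𝕄) : ℚ := -(traceGram x).det

/-- Unfolding of `rungeDiscrSq`. [cite: Runge1999EndomorphismRingsAbelianSurfaces, §6 p. 294] -/
theorem rungeDiscrSq_def (x : Fin 4 → 𝕄) : rungeDiscrSq x = -(traceGram x).det := rfl

/-- **Change of generators**: for `x′ᵢ = Σⱼ Pᵢⱼ xⱼ` the Gram matrix is `P (t(xᵢxⱼ)) ᵗP`.
[cite: Runge1999EndomorphismRingsAbelianSurfaces, §6 p. 294] -/
theorem traceGram_linComb (P : Matrix (Fin 4) (Fin 4) ℚ) (x : Fin 4 → 𝕄) :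
    traceGram (fun i ↦ ∑ j, P i j • x j) = P * traceGram x * Pᵀ := by
  ext i k
  simp only [traceGram_apply, Matrix.mul_apply, Matrix.transpose_apply, Finset.sum_mul, Finset.mul_sum,
    smul_mul_assoc, mul_smul_comm, map_sum, map_smul, smul_eq_mul]
  refine Finset.sum_congr rfl fun j _ ↦ Finset.sum_congr rfl fun l _ ↦ ?_
  ring

/-- **`d(x′)² = det(P)² · d(x)²`** — in particular the discriminant of a `ℤ`-module does not depend on the chosen
`ℤ`-basis (`det P = ±1`). [cite: Runge1999EndomorphismRingsAbelianSurfaces, §6 p. 294] -/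
theorem rungeDiscrSq_linComb (P : Matrix (Fin 4) (Fin 4) ℚ) (x : Fin 4 → 𝕄) :
    rungeDiscrSq (fun i ↦ ∑ j, P i j • x j) = P.det ^ 2 * rungeDiscrSq x := by
  rw [rungeDiscrSq, rungeDiscrSq, traceGram_linComb, Matrix.det_mul, Matrix.det_mul, Matrix.det_transpose]; ring

/-- Basis changes with `det P = ±1` (e.g. `(1, X(m,q), X(n,q′), X(m,q)X(n,q′))` versus `(1, α, β, αβ)`) leave `d²`
unchanged. [cite: Runge1999EndomorphismRingsAbelianSurfaces, §6 p. 294] -/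
theorem rungeDiscrSq_linComb_of_det_sq_eq_one {P : Matrix (Fin 4) (Fin 4) ℚ} (hP : P.det ^ 2 = 1) (x : Fin 4 → 𝕄) :
    rungeDiscrSq (fun i ↦ ∑ j, P i j • x j) = rungeDiscrSq x := by
  rw [rungeDiscrSq_linComb, hP, one_mul]

/-- **Non-degenerate trace form ⟹ independence**: if `det(t(xᵢxⱼ)) ≠ 0` then `x₁, …, x₄` are linearly independent
over `ℚ`. [cite: Runge1999EndomorphismRingsAbelianSurfaces, §6 p. 294] -/
theorem linearIndependent_of_det_traceGram_ne_zero {x : Fin 4 → 𝕄} (h : (traceGram x).det ≠ 0) :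
    LinearIndependent ℚ x := by
  rw [Fintype.linearIndependent_iff]
  intro c hc
  have hv : c ᵥ* traceGram x = 0 := by
    ext j
    have hj : rungeTrace ((∑ i, c i • x i) * x j) = 0 := by rw [hc, zero_mul, map_zero]
    simpa [Matrix.vecMul, dotProduct, Finset.sum_mul, smul_mul_assoc, map_sum, map_smul] using hj
  exact congrFun (Matrix.eq_zero_of_vecMul_eq_zero h hv)

variable (q q' : Fin 5 → ℤ)

/-- `α = R₀(q)` over `ℚ`. -/
local notation "α" => Matrix.map (humbertRatRep q) (Int.cast : ℤ → ℚ)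
/-- `β = R₀(q′)` over `ℚ`. -/
local notation "β" => Matrix.map (humbertRatRep q') (Int.cast : ℤ → ℚ)

/-- **The integer Gram matrix `(t(xᵢxⱼ))` of `(x₁, x₂, x₃, x₄) = (1, α, β, αβ)`** in the letters `b = t(α)`,
`N = n(α) = ac + de`, `b′`, `N′`, `τ = t(αβ) = bb′ − N(q,q′)`: rows `(2, b, b′, τ)`, `(b, b² − 2N, τ, bτ − Nb′)`,
`(b′, τ, b′² − 2N′, b′τ − N′b)`, `(τ, bτ − Nb′, b′τ − N′b, τ² − 2NN′)` (`traceGram_humbertPairFam`).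
[cite: Runge1999EndomorphismRingsAbelianSurfaces, §6 p. 294 and Thm. 7 (p. 295)] -/
def pairGram (q q' : Fin 5 → ℤ) : Matrix (Fin 4) (Fin 4) ℤ :=
  !![2, q 1, q' 1, q 1 * q' 1 - humbertNormPolar q q';
    q 1, q 1 ^ 2 - 2 * humbertNormTerm q, q 1 * q' 1 - humbertNormPolar q q',
      q 1 * (q 1 * q' 1 - humbertNormPolar q q') - humbertNormTerm q * q' 1;
    q' 1, q 1 * q' 1 - humbertNormPolar q q', q' 1 ^ 2 - 2 * humbertNormTerm q',
      q' 1 * (q 1 * q' 1 - humbertNormPolar q q') - humbertNormTerm q' * q 1;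
    q 1 * q' 1 - humbertNormPolar q q', q 1 * (q 1 * q' 1 - humbertNormPolar q q') - humbertNormTerm q * q' 1,
      q' 1 * (q 1 * q' 1 - humbertNormPolar q q') - humbertNormTerm q' * q 1,
      (q 1 * q' 1 - humbertNormPolar q q') ^ 2 - 2 * humbertNormTerm q * humbertNormTerm q']

/-- **The trace form of `(1, α, β, αβ)` is `pairGram`** (the sixteen values `t(xᵢxⱼ)`).
[cite: Runge1999EndomorphismRingsAbelianSurfaces, §6 p. 294 and Thm. 7 (p. 295)] -/
theorem traceGram_humbertPairFam : traceGram (humbertPairFam q q') = (pairGram q q').map (Int.cast : ℤ → ℚ) := by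
  have h11 := rungeTrace_alpha_sq q
  have h22 : rungeTrace (β * β) = (q' 1 : ℚ) ^ 2 - 2 * humbertNormTerm q' := rungeTrace_alpha_sq q'
  have h12 := rungeTrace_pair q q'
  have h13 := rungeTrace_alpha_pair q q'
  have h23 := rungeTrace_beta_pair q q'
  have h33 := rungeTrace_pair_sq q q'
  have h21 : rungeTrace (β * α) = (q 1 : ℚ) * q' 1 - humbertNormPolar q q' := by rw [rungeTrace_mul_comm, h12]
  have h31 : rungeTrace (α * β * α) = rungeTrace (α * (α * β)) := rungeTrace_mul_comm _ _
  have h32 : rungeTrace (α * β * β) = rungeTrace (β * (α * β)) := rungeTrace_mul_comm _ _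
  ext i j
  fin_cases i <;> fin_cases j <;>
    simp only [traceGram_apply, humbertPairFam, pairGram, Matrix.map_apply, Matrix.of_apply, Matrix.cons_val',
      Matrix.cons_val_zero, Matrix.cons_val_one, Matrix.cons_val, Matrix.empty_val', Matrix.cons_val_fin_one,
      Fin.zero_eta, Fin.mk_one, Fin.reduceFinMk, one_mul, mul_one, rungeTrace_one, rungeTrace_map_humbertRatRep,
      h11, h22, h12, h21, h13, h23, h31, h32, h33] <;>
    push_cast <;> ring

/-- **The omitted computation: `det(t(xᵢxⱼ)) = −(γ²)²`** for `(1, α, β, αβ)` — a polynomial identity in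
`t(α), n(α), t(β), n(β), n(α, β)`. [cite: Runge1999EndomorphismRingsAbelianSurfaces, §6 Thm. 7 (p. 295: "The discriminant of `R` is `d(R) = det(S_Δ)/4`. … The computation of the discriminant is omitted.")] -/
theorem det_pairGram : (pairGram q q').det = -(gammaSq q q') ^ 2 := by
  rw [pairGram, gammaSq, Matrix.det_succ_row_zero]
  simp [Fin.sum_univ_succ, Matrix.det_fin_three, Matrix.submatrix_apply, Fin.succAbove]
  ring

/-- **THEOREM 7's discriminant: `d(1, α, β, αβ)² = −det(t(xᵢxⱼ)) = ((Δ(q)Δ(q′) − Δ(q,q′)²)/4)² = (det S_Δ/4)²`.**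
[cite: Runge1999EndomorphismRingsAbelianSurfaces, §6 Thm. 7 (p. 295: "`d(R) = det(S_Δ)/4`")] -/
theorem rungeDiscrSq_humbertPairFam :
    rungeDiscrSq (humbertPairFam q q') =
      (((humbertInvariant q * humbertInvariant q' - humbertPolar q q' ^ 2 : ℤ) : ℚ) / 4) ^ 2 := by
  have hdet : (traceGram (humbertPairFam q q')).det = (((pairGram q q').det : ℤ) : ℚ) := by
    rw [traceGram_humbertPairFam]; exact (Int.cast_det _).symm
  have h4 := four_mul_gammaSq q q'
  rw [rungeDiscrSq, hdet, det_pairGram]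
  have : ((humbertInvariant q * humbertInvariant q' - humbertPolar q q' ^ 2 : ℤ) : ℚ) = -4 * gammaSq q q' := by
    rw [show humbertInvariant q * humbertInvariant q' - humbertPolar q q' ^ 2 = -(4 * gammaSq q q') by rw [h4]; ring]
    push_cast; ring
  rw [this]; push_cast; ring

/-- The same value as the square of the INTEGER `γ² = gammaSq q q′ = −det S_Δ/4`.
[cite: Runge1999EndomorphismRingsAbelianSurfaces, §6 Thm. 7 and its proof (p. 295)] -/
theorem rungeDiscrSq_humbertPairFam_eq_gammaSq_sq : rungeDiscrSq (humbertPairFam q q') = ((gammaSq q q' : ℤ) : ℚ) ^ 2 := by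
  have hdet : (traceGram (humbertPairFam q q')).det = (((pairGram q q').det : ℤ) : ℚ) := by
    rw [traceGram_humbertPairFam]; exact (Int.cast_det _).symm
  rw [rungeDiscrSq, hdet, det_pairGram]; push_cast; ring

variable {q q'}

/-- **`1, α, β, αβ` are linearly independent over `ℚ` as soon as `det S_Δ ≠ 0`** (the trace form is then
non-degenerate) — "`R ⊗ ℚ = ℚ ⊕ ℚα ⊕ ℚβ ⊕ ℚαβ`", independence half, WITHOUT the hypothesis `Δ(q) ≠ 0` of row A4-66 FILE 2.
[cite: Runge1999EndomorphismRingsAbelianSurfaces, §6 Thm. 7 and its proof (p. 295)] -/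
theorem linearIndependent_humbertPairFam (hS : humbertInvariant q * humbertInvariant q' ≠ humbertPolar q q' ^ 2) :
    LinearIndependent ℚ (humbertPairFam q q') := by
  apply linearIndependent_of_det_traceGram_ne_zero
  rw [← neg_ne_zero, ← rungeDiscrSq_def, rungeDiscrSq_humbertPairFam]
  refine pow_ne_zero 2 (div_ne_zero ?_ (by norm_num))
  exact_mod_cast sub_ne_zero.2 hS

/-- Independence in the form of row A4-66 FILE 2 (the family `![1, α, β, αβ]`), now for `det S_Δ ≠ 0` only.
[cite: Runge1999EndomorphismRingsAbelianSurfaces, §6 Thm. 7 and its proof (p. 295)] -/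
theorem linearIndependent_one_humbertRatRep_pair' (hS : humbertInvariant q * humbertInvariant q' ≠ humbertPolar q q' ^ 2) :
    LinearIndependent ℚ ![(1 : 𝕄), α, β, α * β] :=
  linearIndependent_humbertPairFam hS

/-- **`dim_ℚ ℚ(α, β) = 4` whenever `det S_Δ ≠ 0`.** [cite: Runge1999EndomorphismRingsAbelianSurfaces, §6 Thm. 7 and its proof (p. 295: "`R ⊗ ℚ = ℚ ⊕ ℚα ⊕ ℚβ ⊕ ℚαβ`")] -/
theorem finrank_humbertPairAlg_of_det_ne_zero (hS : humbertInvariant q * humbertInvariant q' ≠ humbertPolar q q' ^ 2) :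
    finrank ℚ (humbertPairAlg q q') = 4 := by
  rw [← Subalgebra.finrank_toSubmodule, ← span_range_humbertPairFam, finrank_span_eq_card (linearIndependent_humbertPairFam hS),
    Fintype.card_fin]

/-- Conversely, a linear dependence among `1, α, β, αβ` kills the trace form: independent ⟸⟹ criterion as
`det(t(xᵢxⱼ)) ≠ 0 ⟹` only; here the contrapositive bookkeeping `d² = 0 ⟹ det S_Δ = 0`.
[cite: Runge1999EndomorphismRingsAbelianSurfaces, §6 Thm. 7 (p. 295)] -/
theorem det_discMatrix_eq_zero_of_rungeDiscrSq_eq_zero (h : rungeDiscrSq (humbertPairFam q q') = 0) :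
    humbertInvariant q * humbertInvariant q' - humbertPolar q q' ^ 2 = 0 := by
  rw [rungeDiscrSq_humbertPairFam] at h
  have h' := pow_eq_zero_iff (n := 2) (by norm_num) |>.1 h
  rw [div_eq_zero_iff] at h'
  rcases h' with h' | h'
  · exact_mod_cast h'
  · norm_num at h'

end Discriminant

end SiegelModuli

end Literature.AlgebraicGeometry.ModuliOfAbelianVarieties
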